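import Mathlib.MeasureTheory.Integral.Bochner.Basic
import Mathlib.MeasureTheory.Constructions.Pi
import Mathlib.MeasureTheory.Measure.Lebesgue.Basic
import Mathlib.Analysis.SpecialFunctions.Trigonometric.Basic
import Mathlib.Analysis.SpecialFunctions.Exp
import Literature.Probability.LatticeModels.LatticeGraph
import HarnessLib

/-!
# Orientational long-range order of the plane rotator (classical XY model) on `(ℤ/Lℤ)³`

Topic `Literature/Probability/LatticeModels`. One NAMED FACT (D-0014, statement only):

* `FriedliVelenik2017_thm1025_planeRotator3` — **infrared-bound long-range order for the classical
  XY model in three dimensions** (Fröhlich–Simon–Spencer, Comm. Math. Phys. 50 (1976) 79–95, as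
  presented in S. Friedli, Y. Velenik, *Statistical Mechanics of Lattice Systems* (CUP 2017),
  Theorem 10.25, p. 502–503 of the held copy, with Theorem 10.24 (infrared bound) and Remark 10.4
  "we will always assume L to be even"): for the Gibbs distribution on the torus `𝕋_L = (ℤ/Lℤ)^d`,
  `d ≥ 3`, with Hamiltonian `β Σ_{{i,j} ∈ ℰ_L} ‖S_i − S_j‖²` (10.38) and a single-spin reference
  measure under which `‖S_i‖ = 1`, one has, with
  `β₀ := (ν/4d) ∫_{[-π,π]^d} {1 − (1/2d) Σ_{j∼0} cos(p·j)}⁻¹ dp < ∞`,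
  `liminf_{L→∞} ⟨‖m_L‖²⟩_{L;β} ≥ 1 − β₀/β` for every `β > β₀` (10.42), `m_L = |𝕋_L|⁻¹ Σ_i S_i`.

## Specialisation typed here (plane rotator, `ν = N = 2`, `d = 3`; WEAKER than print)

Spins `S_x = (cos θ_x, sin θ_x)`, the uniform measure on the circle being the normalised push-forward
of Lebesgue measure on `[0, 2π]`: configurations are angle fields `θ : TorusSite 3 L → ℝ`
integrated over the cube `[0,2π]^Λ` with the product Lebesgue measure (`MeasureTheory.volume`), and
only RATIOS of integrals enter. Since `‖S_x − S_y‖² = 2 − 2 cos(θ_x − θ_y)`, the Boltzmann weight of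
(10.38) is, up to a constant factor that cancels in ratios, `exp(J Σ_{(x,i)} cos(θ_{x+e_i} − θ_x))`
with `J = 2β`, the sum running over DIRECTED bonds `(x,i)`, `i ∈ Fin 3` (for `L ≥ 3` each undirected
torus edge exactly once). `⟨‖m_L‖²⟩ = L⁻⁶ Σ_{x,y} ⟨cos(θ_x − θ_y)⟩`. We state the conclusion for
EVEN `L ≥ 4` in the `ε`-form of the liminf ("for every `ε > 0`, eventually in even `L`,
`plateau ≥ 1 − J₀/J − ε`") and existentially in the threshold `J₀ = 2β₀ > 0` (the printed `β₀` is
explicit). This is exactly the `K = 0` (unperturbed) case of the engine crux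
`Summit.HubbardSuperconductivity.HubbardSuperconductivity.Theses.NodalWardXY.PerturbedXYOrder`, in
the same vocabulary (that item asks in addition for ALL `L ≥ 2`, a uniform plateau `a > 0`, and
stability under complex non-local two-current perturbations — none of which is in print).

## References

* [FriedliVelenikSMLS2017] S. Friedli, Y. Velenik, CUP 2017, Thm. 10.25 (p. 502–503), Thm. 10.24,
  Rem. 10.4, (10.38)–(10.42).
* J. Fröhlich, B. Simon, T. Spencer, Comm. Math. Phys. 50 (1976) 79–95 (original; not re-read).
-/

noncomputable section

namespace Literature.Probability.LatticeModels

open _root_.MeasureTheory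

/-- **Long-range order of the three-dimensional plane rotator at low temperature**
(Fröhlich–Simon–Spencer 1976 via Friedli–Velenik 2017, Thm. 10.25 with Rem. 10.4, even `L`):
there is `J₀ > 0` such that for every coupling `J > J₀` and every `ε > 0`, for all large EVEN sides
`L`, the torus plateau `L⁻⁶ Σ_{x,y} ⟨cos(θ_x − θ_y)⟩_J` of the classical XY model
`exp(J Σ_{(x,i)} cos(θ_{x+e_i} − θ_x)) dθ / Z` on `(ℤ/Lℤ)³` is at least `1 − J₀/J − ε`
(`J = 2β`, `J₀ = 2β₀` in the book's normalisation (10.38), (10.42)). Typed for the plane rotator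
only and in `ε`-liminf form — weaker than print. Grounds the `K = 0` case of
`Summit.HubbardSuperconductivity.HubbardSuperconductivity.Theses.NodalWardXY.PerturbedXYOrder`.
[cite: FriedliVelenikSMLS2017, Thm 10.25 (pp. 502–503) with Thm 10.24 and Rem 10.4] -/
def FriedliVelenik2017_thm1025_planeRotator3 : Prop :=
  ∃ J₀ : ℝ, 0 < J₀ ∧ ∀ J : ℝ, J₀ < J → ∀ ε : ℝ, 0 < ε → ∃ L₀ : ℕ, ∀ (L : ℕ) [NeZero L],
    L₀ ≤ L → Even L → 4 ≤ L →
    let cube : Set (TorusSite 3 L → ℝ) := Set.pi Set.univ (fun _ => Set.Icc (0 : ℝ) (2 * Real.pi))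
    let wJ : (TorusSite 3 L → ℝ) → ℝ := fun θ =>
      Real.exp (J * ∑ b : TorusSite 3 L × Fin 3, Real.cos (θ (b.1 + Pi.single b.2 1) - θ b.1))
    let Z : ℝ := ∫ θ in cube, wJ θ
    1 - J₀ / J - ε ≤
      (∑ x : TorusSite 3 L, ∑ y : TorusSite 3 L, ∫ θ in cube, Real.cos (θ x - θ y) * wJ θ) /
        (Z * (L : ℝ) ^ 6)

end Literature.Probability.LatticeModels

end
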